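import Literature.AnabelianGeometry.EtaleTheta.Discharge.Sec5FirstDatumThetaTwistTower
import Literature.AnabelianGeometry.EtaleTheta.Discharge.Sec5OfQuotientTemperoidRootData
import Literature.AnabelianGeometry.EtaleTheta.Discharge.Sec5RootDivisorInvarianceOfKernel
import Literature.AnabelianGeometry.EtaleTheta.Discharge.Sec5OfQuotientTemperoidDataFirstForm
import HarnessLib

/-!
# [EtTh] §5 — the FIRST §5 DATUM over a tower model, FIRST FORM: one `(l·N)`-th root of the theta function's fraction-pair
# (Prop. 5.2 (i) «an `l·N`-th root of a right fraction-pair of `Θ̈`») — the root slot GENUINELY INHABITED at the tower sockets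

S. Mochizuki, *The étale theta function …*, Publ. RIMS **45** (2009) [MochizukiEtTh2009], Prop. 5.2 (i) p.324 (PDF p.98): «(s_{l·N}, τ_{l·N})
constitutes an `l·N`-th root of a right fraction-pair of `Θ̈`, or, alternatively, an `N`-th root of a right fraction-pair of an `l`-th root
of `Θ̈` [cf. Remark 4.3.2]»; §5 pp.330–331 (PDF pp.104–105); Prop. 4.3 (i) proof p.317 (PDF p.91). [cite: MochizukiEtTh2009, §5 p.330–331 (PDF pp.104–105)]
PAGE CONVENTION for [EtTh]: «printed N (PDF p.M)», N = M + 226.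

abc-iut cell, layer L2 = [EtTh], seat abc-iut-L2-t12 (gen 12), KEY «FILE-1 FIRST-FORM TWIN» (abc-iut-L2-lead gen 9 R1391/R1396; form ruling
R1385 (A): FIRST form, Kummer order `l·N`).  abc-iut-L2-t4's FILE 1 `firstDatum` (p513309) types the root slot by the NESTED binder
`Rt : NthRoot Rl.root Rl.pair N` (S-anchored second form), an EMPTY type at every tower-model socket (abc-iut-L2-d2, F-L2d2g8-2 (C), R1381),
so FILE 1's datum is vacuous in `Rt` there.  THIS FILE re-types the slot by print's FIRST form — ONE `(l·N)`-th root
`RlN : NthRoot Θ̈ (s′, s″) (l·N)` of the theta function's fraction-pair itself, INHABITED at every tower socket (abc-iut-L2-d2's B1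
`nonempty_nthRoot_theta … (l·N)` = FILE 1's `nonempty_nthRoot_theta_mul`) — over abc-iut-L2-t3's generic root-datum core
`ThetaFrobenioid.ofQuotientTemperoidRootData` (p517100, KEY «JUNCTION TWIN» R1374) at `(f, P, M) := (Θ̈, (s′, s″), l·N)`, `A_⊚ := A_⊙`,
`T : ThetaEnvData (l·N)`; it is abc-iut-L2-t3's first-form instance `ofQuotientTemperoidDataFirstForm` at the tower carrier (same term; the
`rfl` bridge and `Facts ⟸ {hM, hK}` follow as an append once that instance lands).  ADDITIVE: nothing landed is edited; inputs BY NAME.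
* **`firstDatumFirstForm`** at abc-iut-L2-t4's carrier `settingTheta R S n X φ hφ`; `hinvc` a THEOREM by the ONE-STEP engine
  (`BiKummerSetting.NthRoot.pull_aut_div_num` over B1's `hθ_thetaNum` — no `A_l` in between); `hinvp` displayed in the core's shape and
  DISCHARGED from the level clause `hM : φ(ιX(Π^tp_Ÿ)) ⊆ V_n` alone (`hinvp_firstForm_of_hM`, ONE-STEP `pull_galoisSurj_div_den_of_mem`
  along `H_⊙ = Ker ρ_{A_⊙}` — abc-iut-L2-t3's kernel route, no hypothesis on `Div(s″)`);
* the rfl dictionary `firstDatumFirstForm_dictionary` (`Π^tp_X, A_⊙, Θ̈, A_N, B_N, s^⊓, s^⊔, l, N = l·N₀, K, (l·Δ_Θ)`) and the five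
  UNCONDITIONAL laws (`StrvSection`, `SgpCapSpec`, `SgpCupSpec`, `SgpCapSection`, `AutAmpleBN`) from the core;
* §OF RECORD: `thetaRootLN := (nonempty_nthRoot_theta … (l·N)).some` and **`nonempty_firstDatumFirstForm_of_hM`** — the §5 data over the
  tower model EXIST with binders {`T`/`ιX`, constants ○, `hM`} and NO root binder (contrast FILE 1's nested `Rr`).
HONEST FRAMING: a NON-COUNT model instance (the count is abc-iut-L2-t4's FILE 2 at the carrier of record); the carrier is OUR class-(b)
DESIGN tower, NOT the tempered Frobenioid of a Tate curve; `φ` onto `Compat₃′`, `T`/`ιX`, the constants `(K′, constEmb)` ○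
(degenerate-or-absent at this countable carrier) and `hM` are DISPLAYED; `Facts` (Prop. 4.3 (iii) at order `l·N`) is NOT claimed
in this file.  [EtTh]/[FrdI] are refereed prerequisites; nothing here bears on, or takes a side on, the disputed [IUTchIII] Cor. 3.12;
nothing here asserts abc proved or refuted; typed ≠ proved.
-/

noncomputable section

namespace Literature.AnabelianGeometry.EtaleTheta

open CategoryTheory Opposite Function Literature.AlgebraicGeometry.Frobenioids Literature.AlgebraicGeometry.Frobenioids.QuasiTemperoid
  Literature.AnabelianGeometry.SemiGraphs Literature.AnabelianGeometry.SemiGraphs.GaloisObjects LogDivisorModel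
  LogDivisorModel.GaloisAction LogDivisorTower

namespace ThetaTwistTowerTempered

open LogDivisorModel.TateTowerThetaTwist TateTowerKummerTwistRShear

variable (R S : ((ConnectedPart (BTemp (Compat 3 thetaShear)))ᵒᵖ ⥤ CommMonCat.{0}) → Prop) (n : ℕ) {K : Type 1} [Field K]
  (X : SemiGraphs.TemperedArithmeticGroup.{1} K) (φ : X.Pi →ₜ* Compat 3 thetaShear) (hφ : Function.Surjective φ)

/-! ## §1 The first-form datum: ONE `(l·N)`-th root of `(Θ̈; s′, s″)` -/

variable {lv N₀ : ℕ+} (T : ThetaEnvData.{0} (lv * N₀))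
  {pullFrac : ∀ {A A' : (ThetaTwistTowerTempered.temperedFrobenioid R S).category} (_ : A' ⟶ A),
    (ThetaTwistTowerTempered.temperedFrobenioid R S).biratUnitsModel A →
      (ThetaTwistTowerTempered.temperedFrobenioid R S).biratUnitsModel A'}
  (RlN : (settingTheta R S n X φ hφ).NthRoot (thetaUnit R S n)
    (thetaFractionPair R S n X _ _ _ (fun _ _ _ => True) _ (isFrobeniusTrivial_Aodot R S n) (isGaloisObj_Aodot_base R S n))
    (lv * N₀) pullFrac)
  (odd_l : Odd (lv : ℕ)) (ιX : T.PiX ≃ₜ* X.Pi) (K' : Type) [Field K']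
  (constEmb : K'ˣ →* (ThetaTwistTowerTempered.temperedFrobenioid R S).biratUnitsModel RlN.BN)
  (constEmb_injective : Injective constEmb)
  (hinvp : ∀ y : T.PiX, y ∈ T.PiYdd →
    pull (ThetaTwistTowerTempered.temperedFrobenioid R S).divisorMonoid
      ((settingTheta R S n X φ hφ).galoisSurj RlN.AN.base RlN.αData.isGalois (ιX y)).hom (ModelFrobenioid.div RlN.pair.den) =
      ModelFrobenioid.div RlN.pair.den)

/-- **`hinvc` for the single `(l·N)`-th root, a THEOREM**: `Aut(A_{l·N}^bs)` fixes `Div(s^⊓_{l·N})` — B1's `hθ_thetaNum` (stability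
of the zero divisor of `Θ̈`) propagated along ONE root by `BiKummerSetting.NthRoot.pull_aut_div_num` («the zero divisor `Div(s^⊓_N)` …
descends», §5 p.330 (PDF p.104)). [cite: MochizukiEtTh2009, §5 p.330 (PDF p.104)] -/
theorem hinvc_thetaFirstForm (g : Aut RlN.AN.base) :
    pull (ThetaTwistTowerTempered.temperedFrobenioid R S).divisorMonoid g.hom (ModelFrobenioid.div RlN.pair.num) =
      ModelFrobenioid.div RlN.pair.num :=
  BiKummerSetting.NthRoot.pull_aut_div_num RlN (isGaloisObj_Aodot_base R S n) (fun W => isDivisorial_full R S W)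
    (settingTheta_galoisSurjNatural R S n X φ hφ) (hθ_thetaNum R S n X φ hφ) g

/-- **THE FIRST §5 DATUM OVER A TOWER MODEL, FIRST FORM** — abc-iut-L2-t3's root-datum core at `Θ̈ = thetaUnit R S n` on `A_⊙ = (Y_n, 0)`
with ONE `(l·N)`-th root `RlN` of its fraction-pair (`A_{l·N} → B_{l·N}, s^⊓_{l·N}, s^⊔_{l·N}`), `σ` CONSTRUCTED, `Π^tp_X ↠ Aut_D(B^bs)` from
`φ`, `(l·Δ_Θ)_{(-)} := thetaStub l`, `T` at order `l·N` (R1385); `hinvc` a THEOREM, `hinvp` displayed (discharged from `hM` below).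
[cite: MochizukiEtTh2009, §5 p.330–331 (PDF pp.104–105)] -/
def firstDatumFirstForm : ThetaFrobenioid.{0} (settingTheta R S n X φ hφ).C (ConnectedPart (BTemp (Compat 3 thetaShear))) :=
  ThetaFrobenioid.ofQuotientTemperoidRootData (thetaUnit R S n) (hypotheses_temperedFrobenioid R S) (ThetaCoord.thetaStub (lv : ℕ))
    odd_l RlN ιX K' constEmb constEmb_injective (hinvc_thetaFirstForm R S n X φ hφ RlN) hinvp

/-- **The rfl dictionary** of the first-form datum: `Π^tp_X = T.PiX`, `A_⊙ = (Y_n, 0)` (the domain of `Θ̈`), `Θ̈ = thetaUnit R S n`,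
`(A_N, B_N, s^⊓, s^⊔) :=` those of the single `(l·N)`-th root `RlN`, `(l, N, K) = (lv, l·N₀, K′)` (Kummer order `l·N`, R1385), and
`(l·Δ_Θ)_E = thetaStub l` at every connected covering `E` — all `rfl` (`s^trv = strvOfRoot` is the core's `_strv`); the datum IS the core at `(f, P, M) := (Θ̈, (s′, s″), l·N)`, so every
theorem of `Discharge/Sec5OfQuotientTemperoidRootData.lean` applies verbatim. [cite: MochizukiEtTh2009, §5 p.330–331 (PDF pp.104–105)] -/
theorem firstDatumFirstForm_dictionary :
    (firstDatumFirstForm R S n X φ hφ T RlN odd_l ιX K' constEmb constEmb_injective hinvp).PiX = T.PiX ∧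
    (firstDatumFirstForm R S n X φ hφ T RlN odd_l ιX K' constEmb constEmb_injective hinvp).Acirc = Aodot R S n ∧
    (firstDatumFirstForm R S n X φ hφ T RlN odd_l ιX K' constEmb constEmb_injective hinvp).thetaFn = thetaUnit R S n ∧
    (firstDatumFirstForm R S n X φ hφ T RlN odd_l ιX K' constEmb constEmb_injective hinvp).AN = RlN.AN ∧
    (firstDatumFirstForm R S n X φ hφ T RlN odd_l ιX K' constEmb constEmb_injective hinvp).BN = RlN.BN ∧
    (firstDatumFirstForm R S n X φ hφ T RlN odd_l ιX K' constEmb constEmb_injective hinvp).sCap = RlN.pair.num ∧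
    (firstDatumFirstForm R S n X φ hφ T RlN odd_l ιX K' constEmb constEmb_injective hinvp).sCup = RlN.pair.den ∧
    (firstDatumFirstForm R S n X φ hφ T RlN odd_l ιX K' constEmb constEmb_injective hinvp).l = lv ∧
    (firstDatumFirstForm R S n X φ hφ T RlN odd_l ιX K' constEmb constEmb_injective hinvp).N = lv * N₀ ∧
    (firstDatumFirstForm R S n X φ hφ T RlN odd_l ιX K' constEmb constEmb_injective hinvp).K = K' ∧
    (∀ E : ConnectedPart (BTemp (Compat 3 thetaShear)), (firstDatumFirstForm R S n X φ hφ T RlN odd_l ιX K' constEmb constEmb_injective hinvp).lDelta E = (ThetaCoord.thetaStub (lv : ℕ)).lDelta E) :=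
  ⟨rfl, rfl, rfl, rfl, rfl, rfl, rfl, rfl, rfl, rfl, fun _ => rfl⟩

/-- **`StrvSection` holds UNCONDITIONALLY** at the first-form datum. [cite: MochizukiEtTh2009, §5 p.331 (PDF p.105)] -/
theorem strvSection_firstDatumFirstForm :
    (firstDatumFirstForm R S n X φ hφ T RlN odd_l ιX K' constEmb constEmb_injective hinvp).StrvSection :=
  ThetaFrobenioid.strvSection_ofQuotientTemperoidRootData (thetaUnit R S n) (hypotheses_temperedFrobenioid R S)
    (ThetaCoord.thetaStub (lv : ℕ)) odd_l RlN ιX K' constEmb constEmb_injective (hinvc_thetaFirstForm R S n X φ hφ RlN) hinvp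

/-- **`SgpCapSpec` holds** at the first-form datum. [cite: MochizukiEtTh2009, §5 p.331 (PDF p.105)] -/
theorem sgpCapSpec_firstDatumFirstForm :
    (firstDatumFirstForm R S n X φ hφ T RlN odd_l ιX K' constEmb constEmb_injective hinvp).SgpCapSpec :=
  ThetaFrobenioid.sgpCapSpec_ofQuotientTemperoidRootData (thetaUnit R S n) (hypotheses_temperedFrobenioid R S)
    (ThetaCoord.thetaStub (lv : ℕ)) odd_l RlN ιX K' constEmb constEmb_injective (hinvc_thetaFirstForm R S n X φ hφ RlN) hinvp

/-- **`SgpCupSpec` holds** at the first-form datum. [cite: MochizukiEtTh2009, §5 p.331 (PDF p.105)] -/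
theorem sgpCupSpec_firstDatumFirstForm :
    (firstDatumFirstForm R S n X φ hφ T RlN odd_l ιX K' constEmb constEmb_injective hinvp).SgpCupSpec :=
  ThetaFrobenioid.sgpCupSpec_ofQuotientTemperoidRootData (thetaUnit R S n) (hypotheses_temperedFrobenioid R S)
    (ThetaCoord.thetaStub (lv : ℕ)) odd_l RlN ιX K' constEmb constEmb_injective (hinvc_thetaFirstForm R S n X φ hφ RlN) hinvp

/-- **`SgpCapSection` holds** at the first-form datum. [cite: MochizukiEtTh2009, §5 p.331 (PDF p.105)] -/
theorem sgpCapSection_firstDatumFirstForm :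
    (firstDatumFirstForm R S n X φ hφ T RlN odd_l ιX K' constEmb constEmb_injective hinvp).SgpCapSection :=
  ThetaFrobenioid.sgpCapSection_ofQuotientTemperoidRootData (thetaUnit R S n) (hypotheses_temperedFrobenioid R S)
    (ThetaCoord.thetaStub (lv : ℕ)) odd_l RlN ιX K' constEmb constEmb_injective (hinvc_thetaFirstForm R S n X φ hφ RlN) hinvp

/-- **`B_{l·N}` is Aut-ample** at the first-form datum. [cite: MochizukiEtTh2009, §5 p.330 (PDF p.104)] -/
theorem autAmpleBN_firstDatumFirstForm :
    (firstDatumFirstForm R S n X φ hφ T RlN odd_l ιX K' constEmb constEmb_injective hinvp).AutAmpleBN :=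
  ThetaFrobenioid.autAmpleBN_ofQuotientTemperoidRootData (thetaUnit R S n) (hypotheses_temperedFrobenioid R S)
    (ThetaCoord.thetaStub (lv : ℕ)) odd_l RlN ιX K' constEmb constEmb_injective (hinvc_thetaFirstForm R S n X φ hφ RlN) hinvp

/-! ## §2 `hinvp` for the single root from the level clause `hM` alone (ONE-STEP kernel route) -/

/-- **`hinvp ⟸ hH` for the single `(l·N)`-th root**: `Φ(ρ_{A_{l·N}}(ιX y))` fixes `Div s^⊔_{l·N}` for `y ∈ Π^tp_Ÿ`, from `hH : ιX(Π^tp_Ÿ) ⊆ H_⊙`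
— `H_⊙ = Ker ρ_{A_⊙}` acts trivially on `Φ(A_⊙^bs)` and the stability propagates along ONE root (abc-iut-L2-t3's
`pull_galoisSurj_div_den_of_mem`; NO hypothesis on the polar divisor of `Θ̈`). [cite: MochizukiEtTh2009, Prop 4.3 (i) p.317 (PDF p.91)] -/
theorem hinvp_firstForm_of_hH (hH : ∀ y : T.PiX, y ∈ T.PiYdd → ιX y ∈ (settingTheta R S n X φ hφ).Hodot) (y : T.PiX)
    (hy : y ∈ T.PiYdd) :
    pull (ThetaTwistTowerTempered.temperedFrobenioid R S).divisorMonoid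
      ((settingTheta R S n X φ hφ).galoisSurj RlN.AN.base RlN.αData.isGalois (ιX y)).hom (ModelFrobenioid.div RlN.pair.den) =
      ModelFrobenioid.div RlN.pair.den :=
  haveI : (settingTheta R S n X φ hφ).Hodot.Normal := by unfold BiKummerSetting.Hodot; infer_instance
  BiKummerSetting.NthRoot.pull_galoisSurj_div_den_of_mem RlN (settingTheta R S n X φ hφ).isGalois_Aodot
    (fun W => isDivisorial_full R S W) (settingTheta_galoisSurjNatural R S n X φ hφ) (settingTheta R S n X φ hφ).Hodot
    (fun x hx => (settingTheta R S n X φ hφ).pull_galoisSurj_Aodot_of_mem_Hodot hx _) (ιX y) (hH y hy)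

/-- **`hinvp ⟸ hM`** (the level clause `φ(ιX(Π^tp_Ÿ)) ⊆ V_n` ALONE; `hH ⟸ hM` by FILE 1). [cite: MochizukiEtTh2009, Prop 4.3 (i) p.317 (PDF p.91)] -/
theorem hinvp_firstForm_of_hM (hM : ∀ y : T.PiX, y ∈ T.PiYdd → φ (ιX y) ∈ vOpenNormal 3 thetaShear n) (y : T.PiX)
    (hy : y ∈ T.PiYdd) :
    pull (ThetaTwistTowerTempered.temperedFrobenioid R S).divisorMonoid
      ((settingTheta R S n X φ hφ).galoisSurj RlN.AN.base RlN.αData.isGalois (ιX y)).hom (ModelFrobenioid.div RlN.pair.den) =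
      ModelFrobenioid.div RlN.pair.den :=
  hinvp_firstForm_of_hH R S n X φ hφ T RlN ιX (hH_settingTheta_of_forall_mem R S n X φ hφ ιX T.PiYdd hM) y hy

/-! ## §3 OF RECORD: the chosen `(l·N)`-th root of `(Θ̈; s′, s″)` — the slot INHABITED, the datum GENUINELY inhabited -/

variable (l N : ℕ+)

/-- **THE `(l·N)`-th root of `(Θ̈; s′, s″)` OF RECORD** — chosen (`Classical.choice`) from abc-iut-L2-d2's Prop. 4.2 (iii) instance at the
fourth model at order `l·N` (B1 `nonempty_nthRoot_theta`), `pullFrac := pullFracModel`: Prop. 5.2 (i)'s FIRST form «an `l·N`-th root of a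
right fraction-pair of `Θ̈`» as a kernel object. [cite: MochizukiEtTh2009, Prop 5.2 (i) p.324 (PDF p.98)] -/
def thetaRootLN : (settingTheta R S n X φ hφ).NthRoot (thetaUnit R S n)
    (thetaFractionPair R S n X _ _ _ (fun _ _ _ => True) _ (isFrobeniusTrivial_Aodot R S n) (isGaloisObj_Aodot_base R S n)) (l * N)
    (fun {_} ψ x => (ThetaTwistTowerTempered.temperedFrobenioid R S).pullFracModel ψ x) :=
  (nonempty_nthRoot_theta R S n X φ hφ (l * N)).some

variable (T' : ThetaEnvData.{0} (l * N)) (ιX' : T'.PiX ≃ₜ* X.Pi)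

set_option maxHeartbeats 400000 in -- see the ELABORATION NOTE in FILE 1 §3 (anchor mismatch `Aodot` vs `quotConnZeroObj`)
/-- **`hinvp` at the root OF RECORD from `hM`** (`hinvp_firstForm_of_hM` at `RlN := thetaRootLN`, `pullFrac := pullFracModel`).
[cite: MochizukiEtTh2009, Prop 4.3 (i) p.317 (PDF p.91)] -/
theorem hinvp_thetaRootLN_of_hM (hM : ∀ y : T'.PiX, y ∈ T'.PiYdd → φ (ιX' y) ∈ vOpenNormal 3 thetaShear n) (y : T'.PiX)
    (hy : y ∈ T'.PiYdd) :
    pull (ThetaTwistTowerTempered.temperedFrobenioid R S).divisorMonoid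
      ((settingTheta R S n X φ hφ).galoisSurj (thetaRootLN R S n X φ hφ l N).AN.base (thetaRootLN R S n X φ hφ l N).αData.isGalois
        (ιX' y)).hom (ModelFrobenioid.div (thetaRootLN R S n X φ hφ l N).pair.den) =
      ModelFrobenioid.div (thetaRootLN R S n X φ hφ l N).pair.den :=
  hinvp_firstForm_of_hM R S n X φ hφ T'
    (pullFrac := fun {_} {_} ψ x => (ThetaTwistTowerTempered.temperedFrobenioid R S).pullFracModel ψ x)
    (thetaRootLN R S n X φ hφ l N) ιX' hM y hy

set_option maxHeartbeats 400000 in -- idem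
/-- **THE FIRST-FORM §5 DATUM OF RECORD IS GENUINELY INHABITED**: root slot := `thetaRootLN`, `hinvp` discharged from `hM` — binders
{`T`/`ιX` at order `l·N`, constants `(K′, constEmb)` ○, `hM`}, NO root binder (contrast FILE 1's nested `Rr`, empty at these sockets).
[cite: MochizukiEtTh2009, §5 p.330–331 (PDF pp.104–105)] -/
theorem nonempty_firstDatumFirstForm_of_hM (odd_l' : Odd (l : ℕ)) (K'' : Type) [Field K'']
    (constEmb' : K''ˣ →* (ThetaTwistTowerTempered.temperedFrobenioid R S).biratUnitsModel (thetaRootLN R S n X φ hφ l N).BN)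
    (constEmb'_injective : Injective constEmb')
    (hM : ∀ y : T'.PiX, y ∈ T'.PiYdd → φ (ιX' y) ∈ vOpenNormal 3 thetaShear n) :
    Nonempty (ThetaFrobenioid.{0} (settingTheta R S n X φ hφ).C (ConnectedPart (BTemp (Compat 3 thetaShear)))) :=
  ⟨firstDatumFirstForm R S n X φ hφ T'
    (pullFrac := fun {_} {_} ψ x => (ThetaTwistTowerTempered.temperedFrobenioid R S).pullFracModel ψ x)
    (thetaRootLN R S n X φ hφ l N) odd_l' ιX' K'' constEmb' constEmb'_injective
    (hinvp_thetaRootLN_of_hM R S n X φ hφ l N T' ιX' hM)⟩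

/-! ## §4 (v2, appended 2026-08-27 after abc-iut-L2-t3's first-form instance landed) The bridge to
`ofQuotientTemperoidDataFirstForm` and `Facts` for the first form ⟸ {`hM`, Lemma 5.8's `hK`} -/

section FirstFormBridge

variable {lv' N₀' : ℕ+} (T₁ : ThetaEnvData.{0} (lv' * N₀'))
  {pullFrac₁ : ∀ {A A' : (ThetaTwistTowerTempered.temperedFrobenioid R S).category} (_ : A' ⟶ A),
    (ThetaTwistTowerTempered.temperedFrobenioid R S).biratUnitsModel A →
      (ThetaTwistTowerTempered.temperedFrobenioid R S).biratUnitsModel A'}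
  (RlN₁ : (settingTheta R S n X φ hφ).NthRoot (thetaUnit R S n)
    (thetaFractionPair R S n X _ _ _ (fun _ _ _ => True) _ (isFrobeniusTrivial_Aodot R S n) (isGaloisObj_Aodot_base R S n))
    (lv' * N₀') pullFrac₁)
  (odd_l₁ : Odd (lv' : ℕ)) (ιX₁ : T₁.PiX ≃ₜ* X.Pi) (K₁ : Type) [Field K₁]
  (constEmb₁ : K₁ˣ →* (ThetaTwistTowerTempered.temperedFrobenioid R S).biratUnitsModel RlN₁.BN)
  (constEmb₁_injective : Injective constEmb₁)
  (hinvp₁ : ∀ y : T₁.PiX, y ∈ T₁.PiYdd →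
    pull (ThetaTwistTowerTempered.temperedFrobenioid R S).divisorMonoid
      ((settingTheta R S n X φ hφ).galoisSurj RlN₁.AN.base RlN₁.αData.isGalois (ιX₁ y)).hom (ModelFrobenioid.div RlN₁.pair.den) =
      ModelFrobenioid.div RlN₁.pair.den)

/-- **`firstDatumFirstForm` IS abc-iut-L2-t3's first-form instance `ofQuotientTemperoidDataFirstForm`** (p-landed 2026-08-27, KEY
«JUNCTION TWIN» R1374/R1385) at abc-iut-L2-t4's tower carrier `settingTheta`, with `θ := thetaUnit R S n`, `Q := thetaStub l`,
`hinvc := hinvc_thetaFirstForm` — definitionally (both are the common core at `(Θ̈, (s′, s″), l·N)`).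
[cite: MochizukiEtTh2009, Prop 5.2 (i) p.324 (PDF p.98)] -/
theorem firstDatumFirstForm_eq_ofQuotientTemperoidDataFirstForm :
    firstDatumFirstForm R S n X φ hφ T₁ RlN₁ odd_l₁ ιX₁ K₁ constEmb₁ constEmb₁_injective hinvp₁ =
      ThetaFrobenioid.ofQuotientTemperoidDataFirstForm (hypotheses_temperedFrobenioid R S) (ThetaCoord.thetaStub (lv' : ℕ))
        odd_l₁ RlN₁ ιX₁ K₁ constEmb₁ constEmb₁_injective (hinvc_thetaFirstForm R S n X φ hφ RlN₁) hinvp₁ := rfl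

/-- **Prop. 4.3 (iii) `BiKummerDifferenceMem` for the first-form datum ⟸ the level clause `hM` alone** (abc-iut-L2-t3's
`biKummerDifferenceMem_ofQuotientTemperoidDataFirstForm` — the bi-Kummer difference in `μ_{l·N}(B_{l·N})`, `fixed` being the root's
own clause in the `A_⊙`-anchored setting — with `hH ⟸ hM` by FILE 1's `hH_settingTheta_of_forall_mem`).
[cite: MochizukiEtTh2009, Prop 4.3 (iii) p.317 (PDF p.91); Prop 5.2 (iii) p.324 (PDF p.98)] -/
theorem biKummerDifferenceMem_firstDatumFirstForm
    (hM : ∀ y : T₁.PiX, y ∈ T₁.PiYdd → φ (ιX₁ y) ∈ vOpenNormal 3 thetaShear n) :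
    (firstDatumFirstForm R S n X φ hφ T₁ RlN₁ odd_l₁ ιX₁ K₁ constEmb₁ constEmb₁_injective hinvp₁).BiKummerDifferenceMem :=
  ThetaFrobenioid.biKummerDifferenceMem_ofQuotientTemperoidDataFirstForm (hypotheses_temperedFrobenioid R S)
    (ThetaCoord.thetaStub (lv' : ℕ)) odd_l₁ RlN₁ ιX₁ K₁ constEmb₁ constEmb₁_injective (hinvc_thetaFirstForm R S n X φ hφ RlN₁)
    hinvp₁ (hH_settingTheta_of_forall_mem R S n X φ hφ ιX₁ T₁.PiYdd hM)

/-- **`Facts` at the first-form datum ⟸ {the level clause `hM : φ(ιX(Π^tp_Ÿ)) ⊆ V_n`, Lemma 5.8's arithmetic step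
`hK : ConstantsActByCyclotome`}** — section property, defining relations, Aut-ampleness, total epimorphicity AND Prop. 4.3 (iii) being
THEOREMS (abc-iut-L2-t3's `facts_ofQuotientTemperoidDataFirstForm`; `𝔉 = firstDatumFirstForm …` abbreviates the `hK` binder;
`hK ⟸ {hconst, hgc}` is abc-iut-L2-t4's `constantsActByCyclotome_ofModelData` shape, stated in tree for the nested binder only —
displayed here). [cite: MochizukiEtTh2009, §5 p.330–331 (PDF pp.104–105)] -/
theorem facts_firstDatumFirstForm (hM : ∀ y : T₁.PiX, y ∈ T₁.PiYdd → φ (ιX₁ y) ∈ vOpenNormal 3 thetaShear n)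
    {𝔉 : ThetaFrobenioid.{0} (settingTheta R S n X φ hφ).C (ConnectedPart (BTemp (Compat 3 thetaShear)))}
    (h𝔉 : 𝔉 = firstDatumFirstForm R S n X φ hφ T₁ RlN₁ odd_l₁ ιX₁ K₁ constEmb₁ constEmb₁_injective hinvp₁)
    (hK : 𝔉.ConstantsActByCyclotome) : 𝔉.Facts := by
  subst h𝔉
  exact ThetaFrobenioid.facts_ofQuotientTemperoidDataFirstForm (hypotheses_temperedFrobenioid R S)
    (ThetaCoord.thetaStub (lv' : ℕ)) odd_l₁ RlN₁ ιX₁ K₁ constEmb₁ constEmb₁_injective (hinvc_thetaFirstForm R S n X φ hφ RlN₁)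
    hinvp₁ (hH_settingTheta_of_forall_mem R S n X φ hφ ιX₁ T₁.PiYdd hM) hK

end FirstFormBridge

end ThetaTwistTowerTempered

end Literature.AnabelianGeometry.EtaleTheta

end
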